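import Mathlib
import HarnessLib
import HarnessLib.Audit
import Summits.RiemannHypothesis.Statement
import HarnessLib.Audit.Status.Attr

/-!
Route: NymanBeurling

# Route NymanBeurling — RH as an L² approximation problem (Hardy space / invariant subspaces /
mollifiers)

**Thesis X (words).** The Báez-Duarte distances tend to 0: for every ε > 0 there is a Dirichlet
polynomial
`A(s) = Σ_{k≤N} a_k k^{-s}` with `∫_ℝ |1 - ζ(1/2+it) A(1/2+it)|² dt/(1/4 + t²) < ε`.
(Mellin–Plancherel image of Nyman–Beurling: `dist_{L²(0,∞)}(χ_{(0,1)}, span{ρ(1/(kx)) : k ≤ N})² =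
(1/2π)·` this
integral, since `M[χ_{(0,1)}] = 1/s` and `M[ρ(1/(k·))] = -k^{-s} ζ(s)/s` on `Re s = 1/2`.)

**X (Lean, elaborated; sInf-free and junk-free via `∫⁻`).**
`∀ ε : ℝ, 0 < ε → ∃ (N : ℕ) (a : Fin N → ℂ), ∫⁻ t : ℝ, ENNReal.ofReal (‖1 - riemannZeta (1 / 2 + t *
Complex.I) * ∑ n : Fin N, a n * ((n : ℂ) + 1) ^ (-(1 / 2 + t * Complex.I))‖ ^ 2 / (1 / 4 + t ^ 2)) <
ENNReal.ofReal ε`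

**Assembly.** X → RH is Báez-Duarte's strengthening of the Nyman–Beurling criterion [Nyman1950;
Beurling1955;
BaezDuarte2003 Thm] — a NAMED FACT (cite filed); note the hard direction X → RH is actually the EASY
half in print
(if `ζ(ρ) = 0` with `Re ρ > 1/2`, the Hardy-space functional `f ↦ (Mf)(ρ)` is bounded on `H²` of the
half-plane,
kills every `ζ·A/s` and not `1/s`), so #1 may well be proved outright in Lean (Paley–Wiener for the
Mellin transform is
the only heavy input).

**Why this line (imports: functional analysis — Hardy spaces `H²`, Beurling's invariant-subspace
theorem, reproducing
kernels; and the MOLLIFIER technology of Levinson–Conrey).** Beurling's proof identifies the closed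
span of
`{ρ(θ/x)}` with a shift-invariant subspace and reads RH off inner/outer factorisation; Burnol and
BBLS turned the rate
into a spectral quantity: conjecturally `d_N² ~ (2 + γ - log 4π)/log N` [BBLS2000], with `2 + γ -
log 4π = Σ_ρ 1/|ρ|²`,
and lower bounds of that order are theorems [Burnol2002]. The optimal `A` is a mollifier of ζ on the
critical line —
the same object that drives `criticalLineProportion` results (Levinson1974, Conrey1989 in Literature
ZeroCounting) —
so progress on explicit near-optimal Dirichlet polynomials [BettinConreyFarmer2013] is progress on
X. Distinct
from Weil positivity: X is a statement about ζ on the critical line only, in `L²(dt/(1/4+t²))`.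

**Ranked cruxes.**
- #2 RATE: `∃ C, ∀ N ≥ 2, ∃ a, ∫ … ≤ C / log N` — BBLS-conjecture strength (implies X, RH and, in
sharp form, simplicity
  information); the natural output of a Hilbert-space proof. Hardest/most informative.
- #3 EXPLICIT MOLLIFIER: X holds with the smoothed Möbius weights `a_k = μ(k)(1 - log k/log N)` —
ties X to
  Levinson–Conrey mollifiers; RH-strength unconditionally; its status under RH to be pinned by the
refuter
  ([BaezDuarte2003 §3; BettinConreyFarmer2013] discuss exactly this family).
- #4 `Summit.RiemannHypothesis → X` — the deep half of Báez-Duarte's theorem (calibration;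
fact-backed).

**Kill criteria.** (i) A certified lower bound `d_N² ≥ c₀ > 0` for all N refutes RH. (ii) If #3 is
refuted UNDER RH in
print (the smoothed Möbius mollifier provably fails), replace #3 by the BCF near-optimal polynomial;
not a kill.
(iii) Close as reformulation if grounder shows every known route to #2 inputs zero-density/RH-type
information
equivalent to route Strip's crux #2 (then merge into Strip).

**Not decomposed yet.** No Hardy-space objects (`H²(Re s > 1/2)`, Beurling factorisation) are
requested as
definitions until #1 is attempted; no second-moment (`∫|ζ|²`) lemmas; no link item to
`criticalLineProportion`.

Rationale: WHY THIS LINE. Nyman–Beurling–Báez-Duarte turns RH into an L² approximation problem on the critical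
line: RH ⟺ X, where X = NbThesis says that for every ε > 0 some Dirichlet polynomial A(s) = Σ_{k<N}
a_k (k+1)^{-s} achieves ∫|1 − ζ(1/2+it)A(1/2+it)|² dt/(1/4+t²) < ε [BaezDuarte2003 =
arXiv:math/0205003 Thm 1.1; d_N form printed in BettinConreyFarmer2013 = arXiv:1211.5191 §1]. Both
halves are kernel-checked in the tree
(Summit.RiemannHypothesis.RiemannHypothesis.Theorems.nbThesis_iff, from
Literature.NumberTheory.LFunctions.riemannHypothesis_of_dirichlet_approx and
.baezDuarte_dirichlet_onlyIf_holds), so the target is exactly summit-strength and the assembly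
(Assembly, proved: Theorems.nbAssembly_proof) and the converse (NbConverse, proved:
Theorems.nbConverse_holds') are settled. Imported areas: Hardy-space / Mellin–Plancherel functional
analysis (Beurling1955) and the Levinson–Conrey mollifier technology (Conrey–Myerson
arXiv:math/0002254; BettinConreyFarmer2013 Thm 1, vendored and proved WITH its hypothesis (2) as
Literature.NumberTheory.LFunctions.BettinConreyFarmer2013_thm1_holds). What remains open is
quantitative: the rate d_N² ≍ 1/log N (BDBLS2000 doi:10.1006/aima.1999.1861 conjecture; floor
Burnol2002 = arXiv:math/0103058 Thm 1.3 = Literature.Barriers.RiemannHypothesis.Burnol2002_thm1_3)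
and whether the explicit smoothed Möbius polynomial V_N realises X.
RANKED CRUXES. #2 NbRateLog — ∃ C ∀ N ≥ 2 ∃ A_N: ∫ ≤ C/log N (why it might fail: printed only under
RH + Σ|ζ'(ρ)|⁻² ≪ T^{3/2−δ}, BCF Thm 1; RH alone gives (log log N)^{5/2+o(1)}/√log N,
BalazardDeRoton2010 = arXiv:0812.1689 Thm 1; C is forced ≥ 2π Σ m_ρ²/|ρ|² (Burnol; in tree
Theorems.two_pi_mul_zeroSumMultSq_le_of_nbRateBound); implies RH
(Theorems.riemannHypothesis_of_nbRateLog)). #2 NbRateOfRH — Summit.RiemannHypothesis → NbRateLog,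
the Bettin–Conrey–Farmer open question isolated from the proved calibration (why it might fail: open
in print since 2000; needs control of ζ·A within ≍1/log N of the zeros, outside every proven
RH-conditional negative-moment range, BuiFlorea2023 = arXiv:2302.07226 Thm 1.2). #3
NbMoebiusMollifier — X with the explicit weights a_k = μ(k)(1 − log k/log N) (why it might fail: the
unsmoothed truncation diverges in L², Literature.Barriers.RiemannHypothesis.BaezDuarte2000_prop4_4;
∫|1 − ζV_N|² → 0 is known only under RH + (2), which needs simple zeros; implies RH,
Theorems.riemannHypothesis_of_nbMoebiusMollifier). #3 NbMollifierOfRH — Summit.RiemannHypothesis →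
NbMoebiusMollifier = BettinConreyFarmer2013 Thm 1 with hypothesis (2) removed (why it might fail: a
multiple zero or tiny |ζ'(ρ)| can sink this fixed taper 1 − x while the optimal d_N still → 0).
Target #0 NbThesis (= X); support NbConverse (proved); Assembly (proved).
KILL CRITERIA. (i) A theorem ¬NbRateOfRH or ¬NbMollifierOfRH (e.g. RH + a multiple zero ⇒ ∫|1 −
ζV_N|² ↛ 0 made unconditional-on-RH, or a Burnol-type floor with a divergent constant) kills the
corresponding unconditional crux as a line (NbRateLog ⟺ RH ∧ NbRateOfRH, NbMoebiusMollifier ⟺ RH ∧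
NbMollifierOfRH) — pivot #3 to the BCF near-optimal polynomials, and if both conditional cruxes die
the route is the bare proved equivalence and is closed superseded/not-a-thesis. (ii) Any refutation
of NbThesis, NbRateLog or NbMoebiusMollifier is a disproof of RH (each implies RH and NbThesis ⟺
RH), so a refuter landing one decides the summit negatively. (iii) Close as a reformulation (merge
into route Strip) if grounding shows every route to NbRateOfRH inputs zero-density /
pair-correlation information equivalent to another route's crux.
NOT DECOMPOSED YET. No split of NbRateOfRH into near-zero / far-from-zero Hadamard-product analysis
(the prior programme's Thm H/K shape) until a prover proposes it with the analytic inputs vendored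
as named facts; no Hardy-space objects (H²(Re s > 1/2), Beurling inner/outer factorisation)
requested as definitions; no item linking V_N to criticalLineProportion (Levinson/Conrey) beyond the
proved dictionary Theorems.nbMoebiusMollifier_iff_levinson; no numerics item
(Literature.Barriers.RiemannHypothesis.BDBLS2000_uniform: an ε-approximation needs N > exp((C/ε)²),
so certified computation cannot close #0).
CHEAPEST FALSIFIER. For NbMollifierOfRH: evaluate, under RH with ONE hypothetical double zero ρ₀,
the residue contribution N^{ρ₀−s}·polylog terms of ζ(s)V_N(s) in BCF's contour argument
(arXiv:1211.5191 §2) — if the taper 1 − x leaves a non-vanishing main term of order 1 (not o(1)) in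
∫|1 − ζV_N|² dt/(1/4+t²), the conditional crux is false under RH + (one multiple zero) and is
restated with the taper (1 − x)² (prior programme: inf_w q_m(w) = m² at (1 − x)^m); a one-page
computation, no numerics. For NbRateOfRH: check Balazard–de Roton's proof (arXiv:0812.1689 §§3–4)
for where (log log N)^{5/2} enters — if it is the sup of |ζ'/ζ| on Re s = 1/2 + 1/log N
(unimprovable under RH alone by Littlewood's Ω-results), the 1/log N rate needs a genuinely new
input and the crux is re-ranked as the route's single hard core.
SOURCES. BaezDuarte2003 (arXiv:math/0205003); BettinConreyFarmer2013 (arXiv:1211.5191);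
BalazardDeRoton2010 (arXiv:0812.1689); Burnol2002 (arXiv:math/0103058); BDBLS2000
(doi:10.1006/aima.1999.1861); ConreyMyerson (arXiv:math/0002254); BuiFlorea2023 (arXiv:2302.07226);
Beurling1955; LandreauRichard2002 (doi:10.1080/10586458.2002.10504480).
SUPPORT. Landed (Theorems/NymanBeurling*.lean): nbThesis_iff, nbThesis_iff_tendsto,
nbThesis_iff_iInf_eq_zero, not_nbThesis_iff_uniform_floor, nbRateLog_iff_isBigO,
nbRateLog_multiplicity_bound, nbRateLog_const_gt (certified numeric floor on C),
nbMoebiusMollifier_iff_levinson, nb_cruxes_of_levinson_isBigO, integrable_nbIntegrand,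
nb_dist_antitone.

Novelty: NOVELTY (retriage planner, 2026-08-14; searched: lit search "Nyman Beurling criterion" (20 local +
30 remote hits), lit search "Balazard de Roton critère de Báez-Duarte", lit frontier
RiemannHypothesis --since 2020, lit bridges RiemannHypothesis --cross any, lean search
'baezDuarte|NymanBeurling' --decl, barrier catalogue Literature/Barriers/RiemannHypothesis (22
entries, technique_class lines; 5 read at the structured block); page reads: BettinConreyFarmer2013
p.3, BalazardDeRoton2010 pp.1–2, BaezDuarte2003 p.3, Burnol2002 p.2, AlougesDarsesHillion2023
pp.1–3).
Nearest prior art. (1) Thesis X is verbatim Báez-Duarte's criterion in d_N form [BaezDuarte2003 Thm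
1.1 (arXiv:math/0205003 p.3); printed as 'RH iff lim d_N² = 0, d_N² =
inf_{A_N}(1/2π)∫|1−ζA_N(1/2+it)|²dt/(1/4+t²)' in BettinConreyFarmer2013 (arXiv:1211.5191) p.3 §1] —
and RH ↔ X is now PROVED in the tree
(Literature.NumberTheory.LFunctions.baezDuarte_dirichlet_iff_holds,
Literature/NumberTheory/LFunctions/RHClassicalEquivalentsProofs.lean:447; axioms
propext/Classical.choice/Quot.sound, checked), so Assembly (#1) and NbConverse (#4) are one-liners
(.mpr/.mp). (2) Crux #2 NbRateLog is the O-form of the BDBLS conjecture d_N² ~ (2+γ−log 4π)/log N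
[BDBLS2000 doi:10.1006/aima.1999.1861, as printed in BettinConreyFarmer2013 p.3], whose matching
lower bound is a theorem [Burnol2002 Thm 1.3 (arXiv:math/0103058 p.2) =
Literature.Barriers.RiemannHypothesis.Burnol2002_thm1_3; BDBLS2000_uniform], whose best
RH-conditional upper  [refs: 10.1006/aima.1999.1861, math/0205003, 1211.5191, math/0103058, 0812.1689, math/0002254, math/0607733, 2209.10990, 1806.05070, 1705.09921, doi:10.1006/aima.1999.1861, BettinConreyFarmer2013, BalazardDeRoton2010, BaezDuarte2003, Burnol2002, AlougesDarsesHillion2023, BDBLS2000, Beurling1955, DarsesHillion2021, LandreauRichard2002]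

Barriers (technique_class: Nyman-Beurling d_N-rate Dirichlet-polynomial mollifier): BARRIERS (catalogue Literature/Barriers/RiemannHypothesis: 22 entries scanned by technique_class, 5
read).
technique_class: Nyman-Beurling d_N-rate Dirichlet-polynomial mollifier
(tokens shared with the catalogue: Nyman-Beurling, Baez-Duarte-criterion, L2-closure-distance,
Dirichlet-polynomial-approximation, d_N-rate, mollifier; plus smoothed-Moebius-weights, Hardy-space,
Mellin-Plancherel.)
- Literature.Barriers.RiemannHypothesis.NymanBeurlingObstructions (decl
Literature.Barriers.RiemannHypothesis.NymanBeurlingObstructions = BaezDuarte2000_prop4_4 ∧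
BaezDuarte2000_prop4_7 ∧ BDBLS2000_uniform; Burnol2002_thm1_3, BDBLS2000_thm vendored alongside)
[Nyman-Beurling, natural-approximation, fixed-coefficient-series, d_N-rate]: APPLIES squarely. (a)
Prop 4.4 (S_n = Σ_{k≤n} μ(k)ρ_k diverges in L²) kills the unsmoothed Möbius truncation — crux #3
NbMoebiusMollifier evades it by the catalogued evasion 'n-dependent reweighting' (weights μ(k)(1 −
log k/log N) = BCF's V_N; the same class as f_ε = Σ μ(a)a^{−ε}ρ_a of BaezDuarte2003 §3 and as a_k =
μ(k+1)(1−(k+1)/n)²(k+1)^{−δ} in the tree's proof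
Literature.NumberTheory.LFunctions.baezDuarte_dirichlet_onlyIf_holds of #4), and this is recorded as
#3's why-might-fail (the smoothing is load-bearing); (b) Prop 4.7 (no fixed-coefficient series in
the e_k converges) does not touch #2/#3, whose coefficients depend on N; (c) BDBLS2000_uniform, d_N
≥ C/√log N for dilations ≤ N: crux #2 NbRateLog asks for d_N² ≤ C'/log N, the matching order, hence
co

Novelty grade: known — Grade KNOWN (refuter route-review 2026-08-15; graded on the route's own Novelty section, which cites correctly, plus my search: zbMATH 'Nyman Beurling criterion Riemann hypothesis' ≥2014 (20 rows) and 'Báez-Duarte criterion' ≥2014 (21 rows), lit citing arXiv:1211.5191/0812.1689/math-0103058 (13/3/28 (refuter refuter-rreview1-RiemannHypothesis-NymanBeurlin-95401b6e-0, 2026-08-15T18:27:51Z; prior: arXiv:math/0205003 (BaezDuarte2003 Thm 1.1 = thesis; proved in tree: baezDuarte_dirichlet_iff_holds), doi:10.1006/aima.1999.1861 (BDBLS2000 conjecture d_N² ~ C₀/log N = crux NbRateLog in O-form), arXiv:1211.5191 (BettinConreyFarmer2013: Thm 1 = NbMoebiusMollifier under RH+(2), proved in tree; p.3 open question = NbRateOfRH),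 arXiv:math/0103058 (Burnol2002 Thm 1.3 floor), arXiv:0812.1689 (BalazardD)

History (route lifecycle, newest last):
- 2026-08-15T16:29:47Z · rev 2: restated Assembly (stmt-RiemannHypothesis-0393 proved), NbConverse (stmt-RiemannHypothesis-0396 proved) — route-repair(glue) step 2: restate Assembly := NbThesis → Summit.RiemannHypothesis and NbConverse := Summit.RiemannHypothesis → NbThesis BY NAME (definitionally (planner-rbadge-RiemannHypothesis-NymanBeurling-95401b6e-g2-0)
- 2026-08-16T04:16:24Z · AUTO-CRUX (backfill): NbThesis — hypotheses of the deciding theorem that nothing in the route derives are cruxes (operator:999:1085951)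
- 2026-08-24T19:37:19Z · DORMANT — reconciler: no traction for 7 d (last activity item-evidence-added at 2026-08-17T18:37:35Z); parked, not closed — `ledger route dormant route-RiemannHypothesis- (operator:999:2178561)
- 2026-08-26T05:06:13Z · REACTIVATED — reconciler: reactivated — activity item-evidence-added at 2026-08-26T03:45:31Z after parking at 2026-08-24T19:37:19Z (operator:999:2096677)

sub-problem: RiemannHypothesis · status: open · opened planner-RiemannHypothesis-Survey-0 2026-08-13T06:11:43Z · rev 2 · ledger route-RiemannHypothesis-NymanBeurling
GENERATED by the gate from the ledger (D-0016/17). Provers cite these decls: `theorem foo : Summit.RiemannHypothesis.RiemannHypothesis.Theses.NymanBeurling.<Decl> := …` in Summits/RiemannHypothesis/RiemannHypothesis/Theorems/<Name>.lean.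
-/

namespace Summit.RiemannHypothesis.RiemannHypothesis.Theses.NymanBeurling

open scoped BigOperators Topology Manifold Classical MeasureTheory ProbabilityTheory Matrix InnerProductSpace ComplexConjugate ContinuousMap
open Filter Set Function TopologicalSpace MeasureTheory

attribute [summit_statement] _root_.Summit.RiemannHypothesis

open Summit

/-- item stmt-RiemannHypothesis-0392 · crux (kind.auto-crux: conjecture-grade) · rank 0 · open · by planner
why it might fail: X ⟺ RH, both halves PROVED in tree (Literature.NumberTheory.LFunctions.baezDuarte_dirichlet_iff_holds): X fails iff ζ has a zero off Re s = 1/2. No finite certificate: d_N ≥ C/√log N (BDBLS) ⇒ an ε-approximation needs N > exp((C/ε)²); under RH the best printed rate is (log log N)^{5/2+o(1)}/√log N (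
sources: BaezDuarte2003 = arXiv:math/0205003 p.3 Thm 1.1 (RH ⟺ χ ∈ closure(B_nat)); Dirichlet-polynomial form printed in BettinConreyFarmer2013 = arXiv:1211.5191 p.3 §1 first display, Literature.NumberTheory.LFunctions.baezDuarte_dirichlet_iff_holds (Literature/NumberTheory/LFunctions/RHClassicalEquivalentsProofs.lean:447): RH ↔ X proved, axioms [propext, Classical.choice, Quot.sound] checked by #guard_msgs (planner AxCheck.lean rc0), Literature.Barriers.RiemannHypothesis.BDBLS2000_uniform and NymanBeurlingObstructions.cost (Literature/Barriers/RiemannHypothesis/NymanBeurlingObstructions.lean): every ε-approximation needs N > exp((C/ε)²), BalazardDeRoton2010 = arXiv:0812.1689 p.1 abstract (RH ⇒ d_N² ≤ (log log N)^{5/2+o(1)}(log N)^{-1/2}), Burnol2002 = arXiv:math/0103058 p.2 Thm 1.3 (liminf D(λ)√log(1/λ) ≥ √Σ m_ρ²/|ρ|²)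
Thesis X of route NymanBeurling: for every ε > 0 there are N and coefficients a_0..a_{N−1} with ∫_ℝ
|1 − ζ(1/2+it) Σ_{k=1}^{N} a_{k−1} k^{−(1/2+it)}|² dt/(1/4+t²) < ε. This is 2π ·
dist²_{L²(0,∞)}(χ_(0,1), span{ρ(1/(kx)) : k ≤ N}) → 0 via Mellin–Plancherel (M[χ] = 1/s,
M[ρ(1/(k·))] = −k^{−s}ζ(s)/s). RH ↔ X [Nyman1950; Beurling1955; BaezDuarte2003]. Stated with the
lower Lebesgue integral ∫⁻ (no integrability side condition; the integrand is integrable by the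
Hardy–Littlewood second moment ∫_0^T |ζ(1/2+it)|² ~ T log T [Titchmarsh1986 Thm 7.3]). -/
@[route_item "route-RiemannHypothesis-NymanBeurling", crux]
def NbThesis : Prop :=
  ∀ ε : ℝ, 0 < ε → ∃ (N : ℕ) (a : Fin N → ℂ), ∫⁻ t : ℝ, ENNReal.ofReal (‖1 - riemannZeta (1 / 2 + t * Complex.I) * ∑ n : Fin N, a n * ((n : ℂ) + 1) ^ (-(1 / 2 + t * Complex.I))‖ ^ 2 / (1 / 4 + t ^ 2)) < ENNReal.ofReal ε

/-- item stmt-RiemannHypothesis-0394 · crux · rank 2 · open · by planner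
why it might fail: d_N² ≪ 1/log N is printed only under RH + Σ_{|γ|≤T}|ζ'(ρ)|⁻² ≪ T^{3/2−δ} (BCF Thm 1; forces simple zeros); RH alone gives (log log N)^{5/2+o(1)}/√log N (Balazard–de Roton); Burnol forces C ≥ 2π·Σ m_ρ²/|ρ|², so multiple zeros / tiny |ζ'(ρ)| threaten the 1/log N order; one C for all N ≥ 2; ⇒ RH.
sources: BettinConreyFarmer2013 = arXiv:1211.5191 p.3: Thm 1 (RH + (2) ⇒ (1/2π)∫|1−ζV_N|²dt/(1/4+t²) ~ (2+γ−log 4π)/log N); 'An open question is to determine what the rate of convergence of d_N to zero is, assuming RH'; 'condition (2) implicitly assumes … all simple', BalazardDeRoton2010 = arXiv:0812.1689 p.1 abstract (under RH: d_N² ≤ (log log N)^{5/2+o(1)}(log N)^{-1/2} — best RH-conditional bound, weaker than the item), Burnol2002 = arXiv:math/0103058 p.2 Thm 1.2 (BDBLS: Σ 1/|ρ|²) and Thm 1.3 (Σ m_ρ²/|ρ|²) = Literature.Barriers.RiemannHypothesis.BDBLS2000_thm / Burnol2002_thm1_3; item ∫ = 2π d_N² so C ≥ 2π Σ m_ρ²/|ρ|²,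 BDBLS2000 (doi:10.1006/aima.1999.1861) conjecture d_N² ~ (2+γ−log 4π)/log N, as printed in BettinConreyFarmer2013 p.3; uniform lower bound Literature.Barriers.RiemannHypothesis.BDBLS2000_uniform (BaezDuarte2003 §1 (1.3)), LandreauRichard2002 = doi:10.1080/10586458.2002.10504480 (numerics of d_N; no counter-trend)
There is C with: for every N ≥ 2 some Dirichlet polynomial of length N achieves ∫|1 − ζA|²/(1/4+t²)
≤ C/log N. Conjecture [BBLS2000]: d_N² ~ (2 + γ − log 4π)/log N, where 2 + γ − log 4π = Σ_ρ 1/|ρ|²;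
lower bounds of this order are known [Burnol2002]. Implies X hence RH; the natural output of a
Hardy-space/mollifier proof, and the most informative target (the constant encodes Σ m(ρ)²/|ρ|²,
i.e. simplicity). -/
@[route_item "route-RiemannHypothesis-NymanBeurling", crux]
def NbRateLog : Prop :=
  ∃ C : ℝ, ∀ N : ℕ, 2 ≤ N → ∃ a : Fin N → ℂ, ∫⁻ t : ℝ, ENNReal.ofReal (‖1 - riemannZeta (1 / 2 + t * Complex.I) * ∑ n : Fin N, a n * ((n : ℂ) + 1) ^ (-(1 / 2 + t * Complex.I))‖ ^ 2 / (1 / 4 + t ^ 2)) ≤ ENNReal.ofReal (C / Real.log N)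

/-- item stmt-RiemannHypothesis-1916 · crux · rank 2 · open · by planner
why it might fail: Open in print since 2000: RH alone gives only (log log N)^{5/2+ε}/√log N (Balazard–de Roton). A proof must control ζ·A within ≍1/log N of the zeros, outside every proven negative-moment range (Bui–Florea Thm 1.2: shift ≫ (log T)^{-1/2}); multiple/clustered zeros inflate the constant (Burnol).
sources: BettinConreyFarmer2013 = arXiv:1211.5191 p.3: 'An open question is to determine what the rate of convergence of d_N to zero is, assuming the Riemann hypothesis'; Thm 1 (RH + (2) ⇒ (1/2π)∫|1−ζV_N|²dt/(1/4+t²) ~ (2+γ−log 4π)/log N), BalazardDeRoton2010 = arXiv:0812.1689 = doi:10.1142/s1793042110003307 (RH ⇒ d_N² ≪ (log log N)^{5/2+ε}(log N)^{-1/2}; best printed bound under RH alone), Burnol2002 = arXiv:math/0103058 Thm 1.3 = Literature.Barriers.RiemannHypothesis.Burnol2002_thm1_3 (liminf d_N² log N ≥ Σ m_ρ²/|ρ|²); BDBLS2000 doi:10.1006/aima.1999.1861 (conjecture d_N² ~ C₀/log N), BuiFlorea2023 = arXiv:2302.07226 Thm 1.2 p.3 (RH ⇒ (1/T)∫_T^{2T}|ζ(1/2+α+it)|^{-2k}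 bounds for α ≫ (log T)^{-1/(2k)}); p.4 ('(log log x)^{5/2+ε} is the limitation of the ideas in [S, BR]'), prior programme (unpublished) manuscript v8 Thm H / Thm L (RH ⇒ lim d_N² log N = Σ' m_ρ²/|ρ|²), ASSUMED in its Lean: reserve/prior-2001/Prior/RiemannHypothesis/RiemannHypothesis/Rh_NymanBeurlingClosure_NymanBeurlingClosureV8.lean Interface.thmH, docs/m5/inspiration/RiemannHypothesis/RiemannHypothesis/rh-nyman-beurling-closure.md (prior route nyman-beurling-closure: what was established, where it stalled)
[crux] CONDITIONAL RATE — the Bettin–Conrey–Farmer open question: under RH, for every N ≥ 2 some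
Dirichlet polynomial A(s) = Σ_{k<N} a_k (k+1)^{-s} achieves ∫|1 − ζ(1/2+it)A(1/2+it)|² dt/(1/4+t²) ≤
C/log N, i.e. d_N² ≪ 1/log N (order sharp: BDBLS/Burnol floor, proved in the item's own integrand as
Theorems.nbIntegrand_lowerBound_two_le). Literally `Summit.RiemannHypothesis → NbRateLog`, so
NbRateLog ⟺ Summit.RiemannHypothesis ∧ NbRateOfRH (Theorems.riemannHypothesis_of_nbRateLog): the
residue of crux #2 once the kernel-checked calibration NbThesis ↔ RH is factored out. In print OPEN
[BettinConreyFarmer2013 p.3]; best under RH alone d_N² ≪ (log log N)^{5/2+ε}/√log N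
[BalazardDeRoton2010]; under RH + (2) Σ_{|γ|≤T}|ζ'(ρ)|⁻² ≪ T^{3/2−δ}: ~(2+γ−log 4π)/log N [BCF Thm
1]. Claimed under RH alone (lim d_N² log N = Σ'_ρ m_ρ²/|ρ|²) by the prior programme's unpublished
manuscript (Thm H/L: Gevrey-flat Möbius tapers, near/far Hadamard analysis, RH-conditional negative
second moment of ζ off the line à la Bui–Florea 2023) — ASSUMED, not proved, in its Lean (stockroom
V8 file, Interface.thmH). First jobs: refuter audits that Thm H; prover vendors the analytic inputs
as named facts and adapts the -/
@[route_item "route-RiemannHypothesis-NymanBeurling", crux]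
def NbRateOfRH : Prop :=
  Summit.RiemannHypothesis → ∃ C : ℝ, ∀ N : ℕ, 2 ≤ N → ∃ a : Fin N → ℂ, ∫⁻ t : ℝ, ENNReal.ofReal (‖1 - riemannZeta (1 / 2 + t * Complex.I) * ∑ n : Fin N, a n * ((n : ℂ) + 1) ^ (-(1 / 2 + t * Complex.I))‖ ^ 2 / (1 / 4 + t ^ 2)) ≤ ENNReal.ofReal (C / Real.log N)

/-- item stmt-RiemannHypothesis-0395 · crux · rank 3 · open · by planner
why it might fail: Unsmoothed Σ_{k≤N} μ(k)ρ_k DIVERGES in L² (BaezDuarte2000 Prop 4.4): the (1−log k/log N) smoothing is load-bearing. ∫|1−ζV_N|² → 0 is known only under RH + Σ|ζ'(ρ)|⁻² ≪ T^{3/2−δ} (BCF Thm 1, needs simple zeros): a multiple zero / tiny |ζ'(ρ)| may sink this fixed polynomial while X still holds; ⇒ RH.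
sources: BettinConreyFarmer2013 = arXiv:1211.5191 p.3 Thm 1 with V_N(s) := Σ_{n≤N}(1 − log n/log N)μ(n)n^{-s} = the item's polynomial (Fin N index n ↦ n+1, refuter g3-0 rfl-check); p.3 'in contrast to what one might have expected after viewing the graphs of Landreau and Richards', Literature.Barriers.RiemannHypothesis.BaezDuarte2000_prop4_4 and BaezDuarte2000_prop4_5 (BaezDuarte2000 = arXiv:math/0011254 Props 4.4–4.5: S_n = Σ μ(k)ρ_k diverges in L², ‖χ+S_n‖ ≥ max(C|M(n)+2|/√n, |g(n)|√n)), BaezDuarte2003 = arXiv:math/0205003 p.3 §1 (F_n 'shown ([IUO],[AB]) to diverge in H'; the mollified 'Selberg approximation' S_n of Conrey–Myerson arXiv:math/0002254 = these weights), Literature/Barriers/RiemannHypothesis/MollifierLimitations.lean = Literature.Barriers.RiemannHypothesis.MollifierLimitations (Radziwill2012 Thm 1; BettinGonek2017 Thm 1: controlling 1 − ζM for long mollifiers is quasi-RH-strength), LandreauRichard2002 = doi:10.1080/10586458.2002.10504480 (numerics first suggesting V_N non-optimal)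
X with the explicit 'natural approximation' A_N(s) = Σ_{k≤N} μ(k)(1 − log k/log N) k^{−s} (a
Levinson–Conrey type mollifier of ζ). Unconditionally this implies X hence RH. Its truth UNDER RH is
discussed in [BaezDuarte2003 §3] and [BettinConreyFarmer2013] (who exhibit near-optimal polynomials
and compare with the Möbius choice) — refuter: pin whether RH (± simple zeros) is known to imply
this exact statement; if it is known to FAIL, supersede by the BCF polynomial. Bridge between the
Nyman–Beurling criterion and criticalLineProportion technology (Levinson1974, Conrey1989). -/
@[route_item "route-RiemannHypothesis-NymanBeurling", crux]
def NbMoebiusMollifier : Prop :=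
  ∀ ε : ℝ, 0 < ε → ∃ N : ℕ, ∫⁻ t : ℝ, ENNReal.ofReal (‖1 - riemannZeta (1 / 2 + t * Complex.I) * ∑ n : Fin N, ((ArithmeticFunction.moebius (n + 1) : ℝ) * (1 - Real.log ((n : ℝ) + 1) / Real.log N) : ℂ) * ((n : ℂ) + 1) ^ (-(1 / 2 + t * Complex.I))‖ ^ 2 / (1 / 4 + t ^ 2)) < ENNReal.ofReal ε

/-- item stmt-RiemannHypothesis-1917 · crux · rank 3 · open · by planner
why it might fail: BCF need (2) Σ_{|γ|≤T}|ζ'(ρ)|⁻² ≪ T^{3/2−δ} to sum the residues N^{ρ−s}/(ζ'(ρ)(ρ−s)²) of ζV_N; (2) is unproved under RH and false with one multiple zero. A multiple zero or tiny |ζ'(ρ)| may keep ∫|1−ζV_N|² from → 0 for this FIXED taper 1−x while the optimal d_N still → 0.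
sources: BettinConreyFarmer2013 = arXiv:1211.5191 p.3 Thm 1 with V_N(s) := Σ_{n≤N}(1 − log n/log N)μ(n)n^{-s} (= the item's polynomial, Fin N index n ↦ n+1); p.3 'The condition (2) implicitly assumes that the zeros … are all simple', BaezDuarte2003 = arXiv:math/0205003 p.3 §1 (the 'Selberg approximation' S_n of Conrey–Myerson = these weights; unsmoothed F_n = Σμ(a)ρ_a diverges); Literature.Barriers.RiemannHypothesis.BaezDuarte2000_prop4_4, BuiFlorea2023 = arXiv:2302.07226 p.4 (negative second moment of ζ'(ρ): Gonek/Hejhal conjecture, Ng's conditional use; no unconditional-on-RH upper bound) and p.3 (Gonek's conjecture, only lower bounds proved under RH), prior programme (unpublished): Rh_NymanBeurlingClosure_NymanBeurlingClosureV8.lean Interface.thmK / propKprime (under RH, log N·‖χ+Σμ(n)w(log n/log N)φ_n‖² → Σ' q_{m_ρ}(w)/|ρ|² for ADMISSIBLE (Gevrey-flat) tapers w only; inf_w q_m = m² at (1−x)^m), lean: Summit.RiemannHypothesis.RiemannHypothesis.Theorems.riemannHypothesis_of_nbMoebiusMollifier, .nbThesis_of_nbMoebiusMollifier; planner Sketch.lean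 rc0: NbMollifierOfRH = (Summit.RiemannHypothesis → NbMoebiusMollifier) by rfl
[crux] CONDITIONAL MOLLIFIER: under RH alone the smoothed Möbius (Selberg/Conrey–Myerson) polynomial
V_N(s) = Σ_{n≤N}(1 − log n/log N)μ(n)n^{-s} gives arbitrarily small distance integrals (liminf
form). Literally `Summit.RiemannHypothesis → NbMoebiusMollifier`, so NbMoebiusMollifier ⟺
Summit.RiemannHypothesis ∧ NbMollifierOfRH (Theorems.riemannHypothesis_of_nbMoebiusMollifier). =
[BettinConreyFarmer2013 Thm 1] with its hypothesis (2) Σ_{|Im ρ|≤T} 1/|ζ'(ρ)|² ≪ T^{3/2−δ} REMOVED;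
(2) is open even under RH (Gonek's conditional lower bounds; the Gonek–Hejhal /
Hughes–Keating–O'Connell conjecture ~(6/π³)T) and forces simple zeros. In BCF's proof (2) controls
the residues N^{ρ−s}/(ζ'(ρ)(ρ−s)²) of ζ(s)V_N(s); the prior programme's taper theorem (Thm K) treats
only Gevrey-flat tapers, which excludes V_N's taper 1−x beyond simple zeros. Calibrates crux #3
strictly between RH and RH+(2). -/
@[route_item "route-RiemannHypothesis-NymanBeurling", crux]
def NbMollifierOfRH : Prop :=
  Summit.RiemannHypothesis → ∀ ε : ℝ, 0 < ε → ∃ N : ℕ, ∫⁻ t : ℝ, ENNReal.ofReal (‖1 - riemannZeta (1 / 2 + t * Complex.I) * ∑ n : Fin N, ((ArithmeticFunction.moebius (n + 1) : ℝ) * (1 - Real.log ((n : ℝ) + 1) / Real.log N) : ℂ) * ((n : ℂ) + 1) ^ (-(1 / 2 + t * Complex.I))‖ ^ 2 / (1 / 4 + t ^ 2)) < ENNReal.ofReal ε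

-- earlier NbConverse (stmt-RiemannHypothesis-0396, replaced 2026-08-15T16:29:47Z -> stmt-RiemannHypothesis-10911): proved by Summit.RiemannHypothesis.RiemannHypothesis.Theorems.nbConverse_holds' — Summit.RiemannHypothesis → ∀ ε : ℝ, 0 < ε → ∃ (N : ℕ) (a : Fin N → ℂ), ∫⁻ t : ℝ, ENNReal.ofReal (‖1 - riemannZeta (1 / 2 + t * Complex.I) * ∑ n : Fin N, a n * ((n : ℂ) + 1) ^ (-(1 / 2 + t * Complex.I))‖ ^ 
/-- item stmt-RiemannHypothesis-10911 · support · rank 4 · open · by planner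
sources: BaezDuarte2003 = arXiv:math/0205003 Thm 1.1 (only-if part), §2.2, lean: Summit.RiemannHypothesis.RiemannHypothesis.Theorems.nbConverse_holds' (Theorems/NymanBeurlingNbThesis.lean:59); Literature.NumberTheory.LFunctions.baezDuarte_dirichlet_onlyIf_holds (Literature/NumberTheory/LFunctions/RHClassicalEquivalentsProofs.lean:347)
Deep half of the Nyman–Beurling–Báez-Duarte criterion, RH → X [BaezDuarte2003 = arXiv:math/0205003
Thm 1.1 'only if', §2.2]: under RH the Báez-Duarte distance integrals tend to 0. Restated BY NAME
over the target (the inline form is definitionally equal, rfl). PROVED in tree: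
Summit.RiemannHypothesis.RiemannHypothesis.Theorems.nbConverse_holds' : Summit.RiemannHypothesis →
NbThesis (Theorems/NymanBeurlingNbThesis.lean:59, from
Literature.NumberTheory.LFunctions.baezDuarte_dirichlet_onlyIf_holds,
RHClassicalEquivalentsProofs.lean:347); Theorems.nbConverse_proof : NbConverse still elaborates.
Close with `ledger workitem close <this item> --as proved --by
Summit.RiemannHypothesis.RiemannHypothesis.Theorems.nbConverse_holds'` once the gate renders cyclic
closures as docstring links again (see Assembly). Calibrates X as exactly RH-strength. -/
@[route_item "route-RiemannHypothesis-NymanBeurling", crux]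
def NbConverse : Prop :=
  Summit.RiemannHypothesis → NbThesis

-- earlier Assembly (stmt-RiemannHypothesis-0393, replaced 2026-08-15T16:29:47Z -> stmt-RiemannHypothesis-10910): proved by Summit.RiemannHypothesis.RiemannHypothesis.Theorems.nbAssembly_proof @ 2fbf301ce1ae — (∀ ε : ℝ, 0 < ε → ∃ (N : ℕ) (a : Fin N → ℂ), ∫⁻ t : ℝ, ENNReal.ofReal (‖1 - riemannZeta (1 / 2 + t * Complex.I) * ∑ n : Fin N, a n * ((n : ℂ) + 1) ^ (-(1 / 2 + t * Complex.I))‖ ^ 2 / (1 / 4 + t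
/-- item stmt-RiemannHypothesis-10910 · assembly · rank 1 · open · by planner
sources: BaezDuarte2003 = arXiv:math/0205003 Thm 1.1 (if part), Beurling1955, lean: Summit.RiemannHypothesis.RiemannHypothesis.Theorems.assembly_holds' (Theorems/NymanBeurlingNbThesis.lean:65); Literature.NumberTheory.LFunctions.riemannHypothesis_of_dirichlet_approx (Literature/NumberTheory/LFunctions/NymanBeurlingDirichlet.lean:449)
Elementary half of the Nyman–Beurling–Báez-Duarte criterion, X → RH [BaezDuarte2003 Thm 1.1 'if'
part; Beurling1955]: if the Báez-Duarte distance integrals can be made < ε then RH. Restated BY NAME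
over the target (the 2026-08-13 inline form ∀ ε … → Summit.RiemannHypothesis is definitionally
equal, rfl). PROVED in tree: Summit.RiemannHypothesis.RiemannHypothesis.Theorems.assembly_holds' :
NbThesis → Summit.RiemannHypothesis (Theorems/NymanBeurlingNbThesis.lean:65, from
Literature.NumberTheory.LFunctions.riemannHypothesis_of_dirichlet_approx); Theorems.nbAssembly_proof
: Assembly still elaborates against this body. Close with `ledger workitem close <this item> --as
proved --by Summit.RiemannHypothesis.RiemannHypothesis.Theorems.assembly_holds'` once the gate
renders cyclic closures as docstring links again (route revision note 2026-08-15: a `_holds` link to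
a module importing this Theses file made the render import it → 'already declared'). -/
@[route_item "route-RiemannHypothesis-NymanBeurling", crux]
def Assembly : Prop :=
  NbThesis → Summit.RiemannHypothesis

/-! D-0027 §2.1 — DECIDING THEOREM (planner-authored via `route open/edit --closes-file`; by planner-rbadge-RiemannHypothesis-NymanBeurling-95401b6e-g2-0 2026-08-15T16:29:47Z):
its hypotheses are this route's items and its conclusion the sub-problem Statement (glue_lint), and it elaborates with this file. -/

/-- **Deciding theorem of route NymanBeurling** (D-0027 §2.1): the listed items imply the
sub-problem statement `Summit.RiemannHypothesis`. The target `NbThesis` (the Báez-Duarte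
distance integrals `∫ |1 - ζ(1/2+it) A_N(1/2+it)|² dt/(1/4+t²)` can be made `< ε`) is fed to the
assembly `Assembly` (that approximation property implies RH — the elementary half of the
Nyman–Beurling–Báez-Duarte criterion), whose hypothesis is definitionally `NbThesis`. The cruxes
`NbRateLog`, `NbMoebiusMollifier` (strengthenings, each implying `NbThesis`), their
RH-calibrations `NbRateOfRH`, `NbMollifierOfRH`, and the converse `NbConverse` ride along in the
gate's canonical order and are not needed for the implication. [BaezDuarte2003, Thm. 1.1] -/
@[closes "route-RiemannHypothesis-NymanBeurling"] theorem closes : NbThesis → NbRateLog → NbRateOfRH → NbMoebiusMollifier → NbMollifierOfRH →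
    NbConverse → Assembly → _root_.Summit.RiemannHypothesis :=
  fun hX _ _ _ _ _ hA => hA hX

end Summit.RiemannHypothesis.RiemannHypothesis.Theses.NymanBeurling
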